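import Summits.RiemannHypothesis.RiemannHypothesis.Theorems.TiltedLandingLaw421R3Lens1Coverage4

/-!
# lens-1 (rh33346) — the QUANTITATIVE Jensen dip lemma and the EDGE-dip successor `succ_of_dip_edge` ((CA449)(2) P-TARGET L-EDGE;
landing image per (CA450)(1)/(3c): helper module, ns `RhW08.Lens1Quant`).  Nothing here bears on the truth of RH; RH is not proved;
33346/33347 OPEN.

* `jensenDipLog` — Jensen dip SIGN lemma: `g` entire of order `< 2`, `x` real, `g x ≠ 0`, `0 < Re ((g′/g)′(x))` ⇒ a zero in the cone over `x`.
* `jensenDip_quant` — QUANTITATIVE version by ZERO REMOVAL (`dslope`, `growth_dslope`, `re_inv_sq_ge`, `logDeriv2_factor`): cone zeros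
  with `|Im a| ≥ h` and cone multiplicity (list form) `≤ N` ⇒ `Re((g′/g)′(x))·h² ≤ N`.
* `succ_of_dip_edge` — frame corollary (`EngineHyps5 2 …`): dip jets of `f^{(j+1)}` at a real `xs` with `0 < m·A`, a cone budget `N`, a height
  `h > 0` with `N·|m| < 2·|A|·h²` and the lateral window `max(|xs − x₀| + h − R/2, 0)² + (j+1)·h² ≤ (j+1)·Hs²` ⇒ `∃ u, StTrkDQ … (j+1) u`.
Helpers `abs_re_lt_abs_im_of_re_inv_sq_neg`, `hasDerivAt_poleTerm` are cited by FQN from `RhW08.Lens1Coverage` (file A4).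
-/

set_option linter.unusedVariables false
set_option linter.unusedSectionVars false

namespace RhW08.Lens1Quant

noncomputable section

open Complex Set Filter Metric Topology
open scoped ComplexConjugate
open Literature.Analysis.Complex
open RhIdea6.G17.W07C7 RhIdea6.G17.W07C7.Rev6 RhIdea6.G18.W07C8.Law421BirthS RhIdea6.G19.W07C11.Seam
open RhIdea6.G20.W07C12.Frac RhIdea6.G20.W07C12.StColP RhW07.C12.FieldSplit RhIdea6.G21.W07C13.TentMax
open RhW07.C14.TwoSided RhW07.C14.Classes RhW07.C14.Lineage RhW07.C14.Booking
open RhW07.C13.Heredity RhIdea6.G22.W07C15pre.Injection RhW07.E3.Cell RhW07.E3.Lit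
open RhW08.Round1 RhW08.StSwap RhW08.Round2 RhW08.QuadW RhW08.SealSwapQ RhW08.SealSwap RhW08.SuccB RhW08.SuccSplit
open RhW08.ClusterQ RhW08.ClusterQM

/-! ## §0 Elementary helpers -/

/-- Lower bound of a pole term: `−1/(Im w)² ≤ Re (w²)⁻¹` (`Im w ≠ 0`). -/
theorem re_inv_sq_ge {w : ℂ} (hw : w.im ≠ 0) : -(1 / w.im ^ 2) ≤ ((w ^ 2)⁻¹).re := by
  rw [Complex.inv_re]
  have hre : (w ^ 2).re = w.re ^ 2 - w.im ^ 2 := by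
    rw [sq, Complex.mul_re]; ring
  have hns : Complex.normSq (w ^ 2) = (w.re ^ 2 + w.im ^ 2) ^ 2 := by
    rw [map_pow, Complex.normSq_apply]; ring
  rw [hre, hns]
  have him2 : 0 < w.im ^ 2 := by positivity
  have hden : 0 < (w.re ^ 2 + w.im ^ 2) ^ 2 := by positivity
  rw [neg_le, ← neg_div, div_le_div_iff₀ hden him2]
  nlinarith [sq_nonneg w.re, sq_nonneg w.im, mul_nonneg (sq_nonneg w.re) (sq_nonneg w.im)]

/-- A growth bound forces a nonnegative constant. -/
theorem growthConst_nonneg {q : ℂ → ℂ} {ρ C : ℝ} (hqr : ∀ z, ‖q z‖ ≤ C * Real.exp (‖z‖ ^ ρ)) : 0 ≤ C := by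
  have h := hqr 0
  have hexp : 0 < Real.exp (‖(0 : ℂ)‖ ^ ρ) := Real.exp_pos _
  by_contra hC
  push Not at hC
  have : C * Real.exp (‖(0 : ℂ)‖ ^ ρ) < 0 := mul_neg_of_neg_of_pos hC hexp
  linarith [norm_nonneg (q 0)]

/-! ## §1 Zero removal keeps the class: `dslope` of an entire function of order `< 2` -/

/-- **ZERO REMOVAL.**  `q` entire with `‖q z‖ ≤ C e^{‖z‖^ρ}` and `q a = 0`: `r := dslope q a` is entire, `q z = (z − a)·r z`, and
`‖r z‖ ≤ C e^{(‖a‖+1)^ρ} · e^{‖z‖^ρ}` (maximum modulus on the unit circle about `a`; trivial outside it). -/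
theorem growth_dslope {q : ℂ → ℂ} (hq : Differentiable ℂ q) {ρ C : ℝ} (hρ0 : 0 ≤ ρ)
    (hqr : ∀ z, ‖q z‖ ≤ C * Real.exp (‖z‖ ^ ρ)) {a : ℂ} (ha : q a = 0) :
    Differentiable ℂ (dslope q a) ∧ (∀ z, q z = (z - a) * dslope q a z) ∧
      ∀ z, ‖dslope q a z‖ ≤ (C * Real.exp ((‖a‖ + 1) ^ ρ)) * Real.exp (‖z‖ ^ ρ) := by
  have hC : 0 ≤ C := growthConst_nonneg hqr
  have hd : Differentiable ℂ (dslope q a) := by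
    have h := (Complex.differentiableOn_dslope (univ_mem : (univ : Set ℂ) ∈ 𝓝 a)).2 hq.differentiableOn
    exact differentiableOn_univ.1 h
  have hfac : ∀ z, q z = (z - a) * dslope q a z := by
    intro z
    have h := sub_smul_dslope q a z
    rw [smul_eq_mul, ha, sub_zero] at h
    exact h.symm
  refine ⟨hd, hfac, ?_⟩
  -- the bound on the unit circle about `a`
  set C' : ℝ := C * Real.exp ((‖a‖ + 1) ^ ρ) with hC'
  have hC'C : C ≤ C' := by
    have : 1 ≤ Real.exp ((‖a‖ + 1) ^ ρ) := Real.one_le_exp (by positivity)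
    nlinarith
  have hsphere : ∀ w ∈ sphere a 1, ‖dslope q a w‖ ≤ C' := by
    intro w hw
    have hw1 : ‖w - a‖ = 1 := by simpa [dist_eq_norm] using hw
    have hqw : ‖q w‖ = ‖dslope q a w‖ := by
      rw [hfac w, norm_mul, hw1, one_mul]
    have hwn : ‖w‖ ≤ ‖a‖ + 1 := by
      calc ‖w‖ = ‖(w - a) + a‖ := by ring_nf
        _ ≤ ‖w - a‖ + ‖a‖ := norm_add_le _ _
        _ = ‖a‖ + 1 := by rw [hw1]; ring
    have hmono : Real.exp (‖w‖ ^ ρ) ≤ Real.exp ((‖a‖ + 1) ^ ρ) :=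
      Real.exp_le_exp.2 (Real.rpow_le_rpow (norm_nonneg _) hwn hρ0)
    calc ‖dslope q a w‖ = ‖q w‖ := hqw.symm
      _ ≤ C * Real.exp (‖w‖ ^ ρ) := hqr w
      _ ≤ C * Real.exp ((‖a‖ + 1) ^ ρ) := mul_le_mul_of_nonneg_left hmono hC
  intro z
  have hone : (1 : ℝ) ≤ Real.exp (‖z‖ ^ ρ) := Real.one_le_exp (by positivity)
  have hC'0 : 0 ≤ C' := le_trans hC hC'C
  by_cases hz : ‖z - a‖ < 1
  · -- inside: maximum modulus
    have hin : ‖dslope q a z‖ ≤ C' := by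
      refine Complex.norm_le_of_forall_mem_frontier_norm_le (isBounded_ball (x := a) (r := 1))
        (hd.diffContOnCl) (fun w hw => hsphere w ?_) (subset_closure (mem_ball_iff_norm.2 hz))
      rwa [frontier_ball a one_ne_zero] at hw
    calc ‖dslope q a z‖ ≤ C' := hin
      _ = C' * 1 := (mul_one _).symm
      _ ≤ C' * Real.exp (‖z‖ ^ ρ) := mul_le_mul_of_nonneg_left hone hC'0
  · -- outside: `‖r z‖ = ‖q z‖/‖z − a‖ ≤ ‖q z‖`
    push Not at hz
    have hza : 0 < ‖z - a‖ := lt_of_lt_of_le one_pos hz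
    have hle : ‖dslope q a z‖ ≤ ‖q z‖ := by
      rw [hfac z, norm_mul]
      calc ‖dslope q a z‖ = 1 * ‖dslope q a z‖ := (one_mul _).symm
        _ ≤ ‖z - a‖ * ‖dslope q a z‖ := mul_le_mul_of_nonneg_right hz (norm_nonneg _)
    calc ‖dslope q a z‖ ≤ ‖q z‖ := hle
      _ ≤ C * Real.exp (‖z‖ ^ ρ) := hqr z
      _ ≤ C' * Real.exp (‖z‖ ^ ρ) := mul_le_mul_of_nonneg_right hC'C (le_trans zero_le_one hone)

/-! ## §2 One removal shifts `(q′/q)′` by the pole term -/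

/-- If `q z = (z − a)·r z` (`q, r` entire, `q x ≠ 0`) then `(r′/r)′(x) = (q′/q)′(x) + (x − a)⁻²`. -/
theorem logDeriv2_factor {q r : ℂ → ℂ} (hq : Differentiable ℂ q) (hr : Differentiable ℂ r) {a x : ℂ}
    (hqr : ∀ z, q z = (z - a) * r z) (hx : q x ≠ 0) :
    deriv (fun z => deriv r z / r z) x = deriv (fun z => deriv q z / q z) x + 1 / (x - a) ^ 2 := by
  have hxa : x ≠ a := by
    intro h; apply hx; rw [hqr x, h, sub_self, zero_mul]
  -- `q′ = r + (z − a) r′`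
  have hdq : ∀ z, deriv q z = r z + (z - a) * deriv r z := by
    intro z
    have h : HasDerivAt (fun w => (w - a) * r w) (1 * r z + (z - a) * deriv r z) z :=
      ((hasDerivAt_id z).sub_const a).mul (hr.differentiableAt.hasDerivAt)
    have e : q = fun w => (w - a) * r w := funext hqr
    rw [e, h.deriv, one_mul]
  -- `r′/r = q′/q − 1/(z − a)` near `x`
  have hne_nhds : ∀ᶠ z in 𝓝 x, q z ≠ 0 := (hq.continuous.continuousAt (x := x)).eventually_ne hx
  have hEq : (fun z => deriv r z / r z) =ᶠ[𝓝 x] fun z => deriv q z / q z - 1 / (z - a) := by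
    filter_upwards [hne_nhds] with z hz
    have hza : z - a ≠ 0 := by
      intro h; apply hz; rw [hqr z, h, zero_mul]
    have hrz : r z ≠ 0 := by
      intro h; apply hz; rw [hqr z, h, mul_zero]
    rw [hdq z, hqr z]
    field_simp
    ring
  -- differentiate the right-hand side at `x`
  have hdq' : Differentiable ℂ (deriv q) := by
    have := differentiable_iteratedDeriv_of_entire hq 1
    simpa [iteratedDeriv_one] using this
  have h1 : HasDerivAt (fun z => deriv q z / q z) (deriv (fun z => deriv q z / q z) x) x :=
    ((hdq'.differentiableAt (x := x)).div (hq.differentiableAt) hx).hasDerivAt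
  have h2 : HasDerivAt (fun z : ℂ => 1 / (z - a)) (-(1 / (x - a) ^ 2)) x := RhW08.Lens1Coverage.hasDerivAt_poleTerm 1 hxa
  have h12 : HasDerivAt (fun z => deriv q z / q z - 1 / (z - a))
      (deriv (fun z => deriv q z / q z) x - -(1 / (x - a) ^ 2)) x := h1.sub h2
  rw [hEq.deriv_eq, h12.deriv]
  ring

/-! ## §3 The Jensen dip SIGN lemma for `(g′/g)′` -/

/-- **JENSEN DIP LEMMA (log-derivative form).**  `g` entire, `‖g z‖ ≤ C e^{‖z‖^ρ}` (`0 ≤ ρ < 2`); at a real `x` with `g x ≠ 0` and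
`0 < Re ((g′/g)′(x))` there is a zero `a` of `g` whose open Jensen cone contains `x`: `|x − Re a| < |Im a|`.
[Jensen 1913 / Pólya; Titchmarsh1986 §3.9 Lemma α differentiated once.] -/
theorem jensenDipLog {g : ℂ → ℂ} (hg : Differentiable ℂ g) {ρ C : ℝ} (hρ0 : 0 ≤ ρ) (hρ : ρ < 2)
    (hgr : ∀ z, ‖g z‖ ≤ C * Real.exp (‖z‖ ^ ρ)) {x : ℝ} (hx : g x ≠ 0)
    (hx2 : 0 < (deriv (fun z => deriv g z / g z) x).re) :
    ∃ a : ℂ, g a = 0 ∧ |x - a.re| < |a.im| := by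
  classical
  have hCpos : 0 < C := growthConst_pos hgr hx
  have hgx : 0 < ‖g (x : ℂ)‖ := norm_pos_iff.2 hx
  set δ : ℝ := (deriv (fun z => deriv g z / g z) x).re with hδ
  set K : ℝ := Real.log C - Real.log ‖g (x : ℂ)‖ + 1 with hK
  have hlim : Tendsto (fun R : ℝ ↦ 64 * ((K + (|x| + 2 * R) ^ ρ) / R ^ 2)) atTop (𝓝 0) := by
    simpa using (tendsto_growth_div_sq K x hρ0 hρ).const_mul 64
  obtain ⟨R, hRδ, hRge⟩ := ((hlim.eventually_lt_const hx2).and (eventually_ge_atTop (1 : ℝ))).exists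
  have hRpos : 0 < R := by linarith
  set M : ℝ := C * Real.exp ((|x| + 2 * R) ^ ρ) with hM
  obtain ⟨S, m, ψ, hS, hS', hψd, hψeq, -, hψ'⟩ :=
    titchmarsh_logDeriv_sub_sum hg hx hRpos (norm_le_on_closedBall hρ0 hgr x R)
  have hlog : Real.log (M / ‖g (x : ℂ)‖) + 1 = K + (|x| + 2 * R) ^ ρ := by
    rw [hK, hM, Real.log_div (by positivity) hgx.ne', Real.log_mul hCpos.ne' (Real.exp_pos _).ne',
      Real.log_exp]
    ring
  have hxS : ∀ a ∈ S, (x : ℂ) ≠ a := by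
    intro a ha hxa; exact hx (by rw [hxa]; exact (hS a ha).1)
  have hball : ball (x : ℂ) R ∈ 𝓝 (x : ℂ) := isOpen_ball.mem_nhds (mem_ball_self hRpos)
  have hne_nhds : ∀ᶠ z in 𝓝 (x : ℂ), g z ≠ 0 :=
    (hg.continuous.continuousAt (x := (x : ℂ))).eventually_ne hx
  have hEq : (fun z => deriv g z / g z) =ᶠ[𝓝 (x : ℂ)] fun z => (∑ a ∈ S, (m a : ℂ) / (z - a)) + ψ z := by
    filter_upwards [hball, hne_nhds] with z hz hz0
    rw [hψeq z hz hz0]; ring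
  have hR : HasDerivAt (fun z => (∑ a ∈ S, (m a : ℂ) / (z - a)) + ψ z)
      ((∑ a ∈ S, -((m a : ℂ) / (x - a) ^ 2)) + deriv ψ x) x := by
    have hsum : HasDerivAt (fun z => ∑ a ∈ S, (m a : ℂ) / (z - a)) (∑ a ∈ S, -((m a : ℂ) / (x - a) ^ 2)) x := by
      have h := HasDerivAt.sum (fun a ha => RhW08.Lens1Coverage.hasDerivAt_poleTerm (m a : ℂ) (hxS a ha))
      rwa [Finset.sum_fn] at h
    have hψx : HasDerivAt ψ (deriv ψ x) x :=
      (hψd.differentiableAt hball).hasDerivAt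
    exact hsum.add hψx
  have hderiv_eq : deriv (fun z => deriv g z / g z) x = (∑ a ∈ S, -((m a : ℂ) / (x - a) ^ 2)) + deriv ψ x := by
    rw [hEq.deriv_eq]; exact hR.deriv
  by_contra hcone
  push Not at hcone
  have hterm : ∀ a ∈ S, 0 ≤ ((m a : ℂ) / ((x : ℂ) - a) ^ 2).re := by
    intro a ha
    have hma : ((m a : ℂ) / ((x : ℂ) - a) ^ 2) = (m a : ℝ) * (((x : ℂ) - a) ^ 2)⁻¹ := by
      rw [div_eq_mul_inv]; norm_cast
    rw [hma, Complex.re_ofReal_mul]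
    apply mul_nonneg (Nat.cast_nonneg _)
    by_contra hneg
    push Not at hneg
    have hc := RhW08.Lens1Coverage.abs_re_lt_abs_im_of_re_inv_sq_neg hneg
    have : |x - a.re| < |a.im| := by simpa using hc
    exact absurd this (not_lt.2 (hcone a (hS a ha).1))
  have hre : δ = (∑ a ∈ S, -((m a : ℂ) / (x - a) ^ 2)).re + (deriv ψ x).re := by
    rw [hδ, hderiv_eq, Complex.add_re]
  rw [Complex.re_sum] at hre
  have hsum_nonpos : ∑ a ∈ S, (-((m a : ℂ) / ((x : ℂ) - a) ^ 2)).re ≤ 0 := by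
    apply Finset.sum_nonpos
    intro a ha
    rw [Complex.neg_re]
    linarith [hterm a ha]
  have hψre : (deriv ψ x).re ≤ 64 * ((K + (|x| + 2 * R) ^ ρ) / R ^ 2) := by
    have hxin : (x : ℂ) ∈ closedBall (x : ℂ) (R / 8) := mem_closedBall_self (by linarith)
    calc (deriv ψ x).re ≤ ‖deriv ψ x‖ := Complex.re_le_norm _
      _ ≤ 64 * (Real.log (M / ‖g (x : ℂ)‖) + 1) / R ^ 2 := hψ' _ hxin
      _ = 64 * ((K + (|x| + 2 * R) ^ ρ) / R ^ 2) := by rw [hlog]; ring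
  have : δ < δ := by
    calc δ = _ := hre
      _ ≤ 0 + 64 * ((K + (|x| + 2 * R) ^ ρ) / R ^ 2) := add_le_add hsum_nonpos hψre
      _ < δ := by rw [zero_add]; exact hRδ
  exact lt_irrefl _ this

/-! ## §4 The quantitative Jensen dip (zero removal) -/

/-- **QUANTITATIVE JENSEN DIP.**  `g` entire of order `< 2`, `x` real, `g x ≠ 0`; every zero in the open Jensen cone over `x` has
height `≥ h > 0`, and every list of cone zeros whose linear factors jointly divide `g` has length `≤ N` (cone multiplicity budget).
Then `Re ((g′/g)′(x)) · h² ≤ N`. -/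
theorem jensenDip_quant {g : ℂ → ℂ} (hg : Differentiable ℂ g) {ρ C : ℝ} (hρ0 : 0 ≤ ρ) (hρ : ρ < 2)
    (hgr : ∀ z, ‖g z‖ ≤ C * Real.exp (‖z‖ ^ ρ)) {x : ℝ} (hx : g x ≠ 0) {h : ℝ} (hh : 0 < h)
    (hcone : ∀ a, g a = 0 → |x - a.re| < |a.im| → h ≤ |a.im|) {N : ℕ}
    (hN : ∀ A : List ℂ, (∀ a ∈ A, g a = 0 ∧ |x - a.re| < |a.im|) →
      (∃ q : ℂ → ℂ, Differentiable ℂ q ∧ ∀ z, g z = (A.map (fun a => z - a)).prod * q z) → A.length ≤ N) :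
    (deriv (fun z => deriv g z / g z) x).re * h ^ 2 ≤ N := by
  set δ : ℝ := (deriv (fun z => deriv g z / g z) x).re with hδ
  by_contra hlt
  push Not at hlt
  have hh2 : 0 < h ^ 2 := by positivity
  -- k removals, k ≤ N + 1
  have key : ∀ k : ℕ, k ≤ N + 1 → ∃ (A : List ℂ) (q : ℂ → ℂ) (C' : ℝ), A.length = k ∧
      (∀ a ∈ A, g a = 0 ∧ |x - a.re| < |a.im|) ∧ Differentiable ℂ q ∧
      (∀ z, ‖q z‖ ≤ C' * Real.exp (‖z‖ ^ ρ)) ∧ (∀ z, g z = (A.map (fun a => z - a)).prod * q z) ∧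
      δ - k / h ^ 2 ≤ (deriv (fun z => deriv q z / q z) x).re := by
    intro k
    induction k with
    | zero =>
      intro _
      refine ⟨[], g, C, rfl, by simp, hg, hgr, fun z => by simp, ?_⟩
      simp [hδ]
    | succ k ih =>
      intro hk
      obtain ⟨A, q, C', hlen, hmem, hqd, hqg, hfac, hbd⟩ := ih (by omega)
      -- `q x ≠ 0` and the sign lemma fires for `q`
      have hqx : q x ≠ 0 := by
        intro h0; apply hx; rw [hfac x, h0, mul_zero]
      have hkN : (k : ℝ) ≤ N := by exact_mod_cast (by omega : k ≤ N)
      have hpos : 0 < (deriv (fun z => deriv q z / q z) x).re := by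
        have : (k : ℝ) / h ^ 2 < δ := by
          rw [div_lt_iff₀ hh2]; linarith
        linarith
      obtain ⟨a, ha, hca⟩ := jensenDipLog hqd hρ0 hρ hqg hqx hpos
      have hga : g a = 0 := by rw [hfac a, ha, mul_zero]
      have haim : h ≤ |a.im| := hcone a hga hca
      have haim0 : a.im ≠ 0 := by
        intro h0; rw [h0, abs_zero] at haim; linarith
      -- remove `a`
      obtain ⟨hrd, hqr, hrg⟩ := growth_dslope hqd hρ0 hqg ha
      refine ⟨a :: A, dslope q a, C' * Real.exp ((‖a‖ + 1) ^ ρ), by simp [hlen], ?_, hrd, hrg, ?_, ?_⟩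
      · intro b hb
        rcases List.mem_cons.1 hb with h' | h'
        · rw [h']; exact ⟨hga, hca⟩
        · exact hmem b h'
      · intro z
        rw [hfac z, hqr z, List.map_cons, List.prod_cons]
        ring
      · have hshift := logDeriv2_factor hqd hrd hqr hqx
        have hpole : -(1 / h ^ 2) ≤ ((1 : ℂ) / ((x : ℂ) - a) ^ 2).re := by
          have hw : ((x : ℂ) - a).im ≠ 0 := by simpa using haim0
          have h1 := re_inv_sq_ge hw
          have e : ((1 : ℂ) / ((x : ℂ) - a) ^ 2) = (((x : ℂ) - a) ^ 2)⁻¹ := one_div _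
          rw [e]
          refine le_trans ?_ h1
          have him : ((x : ℂ) - a).im = -a.im := by simp
          rw [him, neg_sq]
          have hsq : h ^ 2 ≤ a.im ^ 2 := by
            have := sq_le_sq' (by linarith [abs_nonneg a.im]) haim
            simpa [sq_abs] using this
          have ha2 : 0 < a.im ^ 2 := by positivity
          rw [neg_le_neg_iff, one_div_le_one_div ha2 hh2]
          exact hsq
        rw [hshift, Complex.add_re]
        push_cast
        rw [add_div, sub_add_eq_sub_sub]
        linarith
  obtain ⟨A, q, C', hlen, hmem, hqd, hqg, hfac, -⟩ := key (N + 1) le_rfl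
  have := hN A hmem ⟨q, hqd, hfac⟩
  omega

/-! ## §5 The EDGE-dip successor in the frame -/

/-- **EDGE-DIP SUCCESSOR.**  Frame `EngineHyps5 2 …`; a non-crossing dip of `f^{(j+1)}` at a real `xs` (`m = f^{(j+1)}(xs)`,
`f^{(j+2)}(xs) = 0`, `2A = f^{(j+3)}(xs)`, `0 < m·A`); a cone multiplicity budget `N` at `xs` (every list of cone zeros of `f^{(j+1)}`
whose linear factors jointly divide it has length `≤ N`); a height `h > 0` with `N·|m| < 2·|A|·h²`; and the LATERAL window clause
`max(|xs − x₀| + h − R/2, 0)² + (j+1)·h² ≤ (j+1)·Hs²`.  Then level `j+1` carries a band state.  (Deep or edge alike; for `N = 2`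
the height condition reads `h² > m/A`.) -/
theorem succ_of_dip_edge {η : ℝ} {f : ℂ → ℂ} {x₀ s hmax R Hs : ℝ} {B j : ℕ}
    (hE : EngineHyps5 2 η f x₀ s hmax R Hs B) {xs m A : ℝ}
    (hm : (m : ℂ) = iteratedDeriv (j + 1) f xs) (h2 : iteratedDeriv (j + 2) f xs = 0)
    (hA : ((2 * A : ℝ) : ℂ) = iteratedDeriv (j + 3) f xs) (hmA : 0 < m * A)
    {N : ℕ} (hN : ∀ L : List ℂ, (∀ a ∈ L, iteratedDeriv (j + 1) f a = 0 ∧ |xs - a.re| < |a.im|) →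
      (∃ q : ℂ → ℂ, Differentiable ℂ q ∧ ∀ z, iteratedDeriv (j + 1) f z = (L.map (fun a => z - a)).prod * q z) →
      L.length ≤ N)
    {h : ℝ} (hh : 0 < h) (hNh : (N : ℝ) * |m| < 2 * |A| * h ^ 2)
    (hwin : (max (|xs - x₀| + h - R / 2) 0) ^ 2 + ((j : ℝ) + 1) * h ^ 2 ≤ ((j : ℝ) + 1) * Hs ^ 2) :
    ∃ u : ℂ, StTrkDQ η f x₀ s hmax R Hs B (j + 1) u := by
  obtain ⟨hdiff, hreal, hgrowth, hs, hsh, hhR, h3R, hHs, hstrip, hHsR, hpair, hcol, hhalf, hη0, hη1, hrem⟩ := hE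
  have hE' : EngineHyps5 2 η f x₀ s hmax R Hs B :=
    ⟨hdiff, hreal, hgrowth, hs, hsh, hhR, h3R, hHs, hstrip, hHsR, hpair, hcol, hhalf, hη0, hη1, hrem⟩
  set g : ℂ → ℂ := iteratedDeriv (j + 1) f with hg_def
  have hgd : Differentiable ℂ g := differentiable_iteratedDeriv_of_entire hdiff (j + 1)
  have hC0 : InClass f Hs := ⟨hdiff, hreal, hgrowth, hstrip⟩
  have hm0 : m ≠ 0 := by
    intro h0; rw [h0, zero_mul] at hmA; exact lt_irrefl _ hmA
  have hgx : g xs ≠ 0 := by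
    rw [← hm]; exact_mod_cast hm0
  have hgne : g ≠ 0 := by
    intro h0; exact hgx (by rw [h0]; rfl)
  have hCj : InClass g Hs := analyticHeredity_landed f Hs (j + 1) hHs hC0 hgne
  obtain ⟨ρ', C', hρ'0, hρ', -, hgr'⟩ := StubAnalyticHeredity.growth_treeForm hgd hCj.2.2.1
  -- `(g′/g)′(xs) = g″(xs)/g(xs) = 2A/m`
  have hdg : Differentiable ℂ (deriv g) := by
    have := differentiable_iteratedDeriv_of_entire hgd 1
    simpa [iteratedDeriv_one] using this
  have hx1 : deriv g xs = 0 := by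
    rw [hg_def, ← iteratedDeriv_succ]; exact h2
  have hL : deriv (fun z => deriv g z / g z) xs = deriv (deriv g) xs / g xs := by
    have h : HasDerivAt (fun z => deriv g z / g z)
        ((deriv (deriv g) xs * g xs - deriv g xs * deriv g xs) / g xs ^ 2) xs :=
      (hdg.differentiableAt.hasDerivAt (x := (xs : ℂ))).div (hgd.differentiableAt.hasDerivAt) hgx
    rw [h.deriv, hx1]; field_simp; ring
  have hδ : (deriv (fun z => deriv g z / g z) xs).re = 2 * A / m := by
    have e : deriv (deriv g) = iteratedDeriv (j + 3) f := by
      rw [hg_def, ← iteratedDeriv_succ, ← iteratedDeriv_succ]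
    rw [hL, e, ← hA, ← hm, ← Complex.ofReal_div, Complex.ofReal_re]
  -- `δ·h² > N`
  have hδh : (N : ℝ) < (deriv (fun z => deriv g z / g z) xs).re * h ^ 2 := by
    rw [hδ]
    have hAm : 2 * A / m = 2 * |A| / |m| := by
      rcases lt_or_gt_of_ne hm0 with hneg | hpos
      · have hA' : A < 0 := by nlinarith
        rw [abs_of_neg hneg, abs_of_neg hA']; ring
      · have hA' : 0 < A := by nlinarith
        rw [abs_of_pos hpos, abs_of_pos hA']
    rw [hAm]
    have hmpos : 0 < |m| := abs_pos.2 hm0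
    rw [div_mul_eq_mul_div, lt_div_iff₀ hmpos]
    linarith
  -- hence a cone zero of height `< h`
  have hex : ∃ a, g a = 0 ∧ |xs - a.re| < |a.im| ∧ |a.im| < h := by
    by_contra hcon
    push Not at hcon
    have := jensenDip_quant hgd hρ'0 hρ' hgr' hgx hh (fun a ha hc => hcon a ha hc) hN
    linarith
  obtain ⟨a, ha, hca, hah⟩ := hex
  have haim : a.im ≠ 0 := by
    intro h0; rw [h0, abs_zero] at hca; exact absurd hca (not_lt.2 (abs_nonneg _))
  obtain ⟨u, hu, hup, hure, huim⟩ := exists_upper_zero_of_nonreal hdiff hreal (j + 1) ha haim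
  -- the lateral band clause for `u`
  have huim' : u.im < h := by
    have : |u.im| < h := by rw [huim]; exact hah
    rwa [abs_of_pos hup] at this
  have hure' : |u.re - x₀| ≤ |xs - x₀| + h := by
    have h1 : |u.re - x₀| ≤ |xs - u.re| + |xs - x₀| := by
      have := abs_sub_le (u.re) xs x₀
      rw [abs_sub_comm u.re xs] at this
      linarith
    have h2' : |xs - u.re| < |u.im| := by rw [hure, huim]; exact hca
    rw [abs_of_pos hup] at h2'
    linarith
  have hmax : max (|u.re - x₀| - R / 2) 0 ≤ max (|xs - x₀| + h - R / 2) 0 :=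
    max_le_max (by linarith) le_rfl
  have hmax0 : 0 ≤ max (|u.re - x₀| - R / 2) 0 := le_max_right _ _
  have hsq1 : (max (|u.re - x₀| - R / 2) 0) ^ 2 ≤ (max (|xs - x₀| + h - R / 2) 0) ^ 2 :=
    pow_le_pow_left₀ hmax0 hmax 2
  have hsq2 : u.im ^ 2 ≤ h ^ 2 := by nlinarith
  have hj0 : (0 : ℝ) ≤ (j : ℝ) + 1 := by positivity
  have hlat : (max (|u.re - x₀| - R / 2) 0) ^ 2 + (((j + 1 : ℕ) : ℝ)) * u.im ^ 2 ≤ (((j + 1 : ℕ) : ℝ)) * Hs ^ 2 := by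
    push_cast
    nlinarith [mul_le_mul_of_nonneg_left hsq2 hj0]
  exact ⟨u, stTrkDQ_of_lateral hE' hgne hu hup hlat⟩

end
end RhW08.Lens1Quant
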